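import Summits.QuantumFields.YangMills.Theorems.BalabanUVNodesN15KingModelAnalyticDeterminantConcavity
import Literature.LinearAlgebra.Matrix.JacobiDerivativeFormula
import HarnessLib

/-!
# BalabanUVNodes ∕ N15 — THE KING-MODEL RUNG (PART Ϭ-l): THE RESPONSE OF THE GAUSSIAN NORMALISATION IS A DERIVATIVE — Jacobi's formula ([HornJohnson2013] 0.8.10) along the affine path
# `A_t = W + tE`: `∂_t det A_t = tr(adj(A_t)·E) = det A_t·tr(A_t⁻¹E)` (any field `ℝ`∕`ℂ`), hence at a real positive definite segment `∂_t ln det A_t = tr(A_t⁻¹E)`; for King's block-field operator between two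
# real-orthogonal backgrounds, `Δ_t = Δ_eff(V) + t·(Δ_eff(U) − Δ_eff(V))`: `∂_t ln det Δ_t = tr(Δ_t⁻¹E)` on `[0,1]`, with endpoint slopes `tr(C(V)E)` at `t = 0` and `tr(C(U)E)` at `t = 1` — PART Ϭ-f's sandwich
# `tr(C(U)E) ≤ ln det Δ_eff(U) − ln det Δ_eff(V) ≤ tr(C(V)E)` IS «the chord of the concave function `t ↦ ln det Δ_t` lies between its endpoint tangents» (King's (3.94)–(3.95) interpolation device,
# with the operator instead of the field interpolated)
# (Track A, DAG node N15 = NE2; FAN-OUT v1.1 §N15 s3 «KING-MODEL RUNG … + what the curved case adds»; count-neutral)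

HONEST FRAMING.  Count-neutral (cell `pub-ymgap`, seat `pub-ymgap-dag-n15-e` g53; `--supports stmt-QuantumFields-27247 --as helper` = K3ᴬ, KEY MAP v3).  §1 over any nontrivially normed field;
§2–§3 at `𝕜 = ℝ` (real-orthogonal backgrounds: the tree's Jacobi formula differentiates `𝕜`-valued paths of a `𝕜`-variable); the interpolation is linear in the OPERATOR `Δ_eff`, not in the link field
(King interpolates the field `A ↦ (j∕R)A`, (3.94)); NOT the loop expansion (3.96)–(3.98); NOT a node discharge (N15 of record untouched); nothing continuum ∕ ℝ⁴ ∕ OS ∕ Clay.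

THE RESULTS:
* §1 (generic) `hasDerivAt_entry_affine`, ★★ `hasDerivAt_det_affine` (`∂_t det(W + tE) = tr(adj(W+tE)·E)` — Literature `hasDerivAt_det` [HJ 0.8.10]), `adjugate_eq_det_smul_inv'` (`adj A = det A·A⁻¹` on the units),
  ★★★ **`hasDerivAt_det_affine_jacobi`** (`∂_t det A_t = det A_t·tr(A_t⁻¹E)` wherever `A_t` is invertible — KING's `∂ ln det = tr(A⁻¹∂A)` in `det` form).
* §2 (`𝕜 = ℝ`) ★★★ **`hasDerivAt_log_det_affine`** (`det A_t ≠ 0` ⟹ `∂_t ln|det A_t| = tr(A_t⁻¹E)`; Mathlib `HasDerivAt.log`).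
* §3 (`𝕜 = ℝ`, real-orthogonal `U, V`, `a, m² > 0`, `c ≥ 0`, nonempty fibre; `E = Δ_eff(U) − Δ_eff(V)`, `Δ_t = Δ_eff(V) + tE`) `posDef_effLapU_segment` (`t ∈ [0,1]` ⟹ `Δ_t ≻ 0`),
  ★★★★ **`hasDerivAt_log_det_effLapU_segment`** (`t ∈ [0,1]` ⟹ `∂_t ln det Δ_t = tr(Δ_t⁻¹E)`), ★★★ **`hasDerivAt_log_det_effLapU_segment_zero`** (slope `tr(C(V)E)` at `t = 0`), ★★★ **`hasDerivAt_log_det_effLapU_segment_one`**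
  (slope `tr(C(U)E)` at `t = 1`), ★★★ **`king_response_chord_between_tangents`** (PART Ϭ-f's sandwich restated with the two slopes as the derivatives at the endpoints).
PRIOR TREE ART (by name): Literature `JacobiDerivativeFormula.hasDerivAt_det` ([HJ] 0.8.10), Ϭ-f (`king_first_order_response_sandwich`), Ϭ-b (`posDef_effLapU`), Mathlib (`HasDerivAt.log`, `Matrix.mul_adjugate`, `Matrix.PosDef.add_posSemidef`,
`Matrix.PosSemidef.smul`).  Dedup (rg at filing): basename 0 files; needles `hasDerivAt_det_affine|hasDerivAt_det_affine_jacobi|hasDerivAt_log_det_affine|hasDerivAt_log_det_effLapU_segment|king_response_chord_between_tangents` 0 tree files.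
Locators: [King1986] (3.94)–(3.95) p.669, (3.89)–(3.90) pp.668–669, (2.14) p.653; [HornJohnson2013] 0.8.10 eq. (0.8.10.1).  0 `sorry`, 0 `def`.
-/

noncomputable section
open scoped BigOperators ComplexConjugate ComplexOrder Matrix.Norms.L2Operator
open Finset Matrix

namespace Summit.QuantumFields.YangMills.BalabanUVNodes.N15KingModelRung.Analytic

open Literature.MathematicalPhysics.QuantumFieldTheory.Balaban1983to89.B5Prop11Plancherel (Tor fine)
open Literature.LinearAlgebra.Matrix (hasDerivAt_det)
open Summit.QuantumFields.YangMills.BalabanUVNodes.N15KingModelRung.CovariantBlock (BlockTree effLapU)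

/-! ## §1 Jacobi along an affine path -/

section Jacobi

variable {𝕜 : Type*} [NontriviallyNormedField 𝕜] {ι : Type*} [Fintype ι] [DecidableEq ι]

omit [Fintype ι] [DecidableEq ι] in
/-- The entries of `t ↦ W + tE` have derivative `E_{ij}`. [folklore] -/
theorem hasDerivAt_entry_affine (W E : Matrix ι ι 𝕜) (t : 𝕜) (i j : ι) : HasDerivAt (fun s : 𝕜 => (W + s • E) i j) (E i j) t := by
  have h := ((hasDerivAt_id t).mul_const (E i j)).const_add (W i j)
  simp only [one_mul] at h
  refine h.congr_of_eventuallyEq (Filter.Eventually.of_forall fun s => ?_)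
  simp [Matrix.add_apply, Matrix.smul_apply, smul_eq_mul]

/-- ★★ **`∂_t det(W + tE) = tr(adj(W+tE)·E)`** (Jacobi's formula, Literature `hasDerivAt_det`). [cite: HornJohnson2013, 0.8.10 eq. (0.8.10.1); King1986, (3.94)–(3.95) p.669] -/
theorem hasDerivAt_det_affine (W E : Matrix ι ι 𝕜) (t : 𝕜) : HasDerivAt (fun s : 𝕜 => (W + s • E).det) ((W + t • E).adjugate * E).trace t :=
  hasDerivAt_det (A := fun s : 𝕜 => W + s • E) (hasDerivAt_entry_affine W E t)

/-- `adj A = det A·A⁻¹` when `det A` is a unit. [folklore] -/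
theorem adjugate_eq_det_smul_inv' {A : Matrix ι ι 𝕜} (hA : IsUnit A.det) : A.adjugate = A.det • A⁻¹ := by
  have h : A⁻¹ * (A * A.adjugate) = A.adjugate := by rw [← Matrix.mul_assoc, Matrix.nonsing_inv_mul _ hA, Matrix.one_mul]
  rw [← h, Matrix.mul_adjugate, Matrix.mul_smul, Matrix.mul_one]

/-- ★★★ **KING's JACOBI FORM: `∂_t det A_t = det A_t·tr(A_t⁻¹E)`** along `A_t = W + tE`, wherever `A_t` is invertible (`∂ ln det = tr(A⁻¹∂A)` in determinant form, any field `ℝ`∕`ℂ`).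
[cite: King1986, (3.94)–(3.95) p.669; HornJohnson2013, 0.8.10 eq. (0.8.10.1)] -/
theorem hasDerivAt_det_affine_jacobi (W E : Matrix ι ι 𝕜) {t : 𝕜} (hA : IsUnit (W + t • E).det) :
    HasDerivAt (fun s : 𝕜 => (W + s • E).det) ((W + t • E).det * ((W + t • E)⁻¹ * E).trace) t := by
  have h := hasDerivAt_det_affine W E t
  rwa [adjugate_eq_det_smul_inv' hA, Matrix.smul_mul, Matrix.trace_smul, smul_eq_mul] at h

end Jacobi

/-! ## §2 The real positive case: `∂_t ln det A_t = tr(A_t⁻¹E)` -/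

section RealLog

variable {ι : Type*} [Fintype ι] [DecidableEq ι]

/-- ★★★ **`∂_t ln|det(W + tE)| = tr((W+tE)⁻¹E)`** over `ℝ` wherever `det(W+tE) ≠ 0` (Jacobi + `(ln∘f)′ = f′∕f`). [cite: King1986, (3.94)–(3.95) p.669; HornJohnson2013, 0.8.10 eq. (0.8.10.1)] -/
theorem hasDerivAt_log_det_affine (W E : Matrix ι ι ℝ) {t : ℝ} (hA : (W + t • E).det ≠ 0) :
    HasDerivAt (fun s : ℝ => Real.log (W + s • E).det) (((W + t • E)⁻¹ * E).trace) t := by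
  have h := (hasDerivAt_det_affine_jacobi W E (isUnit_iff_ne_zero.mpr hA)).log hA
  rwa [mul_div_cancel_left₀ _ hA] at h

end RealLog

/-! ## §3 King's block-field operator between two real-orthogonal backgrounds -/

section Model

variable {d : ℕ} {L : ℕ} [NeZero L] (T : BlockTree d L) (M : Fin (d + 1) → ℕ) [hM : ∀ μ, NeZero (M μ)]
variable {n : Type*} [Fintype n] [DecidableEq n] [Nonempty n]
variable {a c m2 : ℝ} (ha : 0 < a) (hc : 0 ≤ c) (hm : 0 < m2)
variable {U V : Tor (fine L M) × Fin (d + 1) → Matrix n n ℝ} (hU : ∀ bd, U bd ∈ Matrix.unitaryGroup n ℝ) (hV : ∀ bd, V bd ∈ Matrix.unitaryGroup n ℝ)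
include ha hc hm hU hV

/-- THE SEGMENT STAYS POSITIVE DEFINITE: `t ∈ [0,1]` ⟹ `Δ_eff(V) + t(Δ_eff(U) − Δ_eff(V)) = (1−t)Δ_eff(V) + tΔ_eff(U) ≻ 0`. [cite: King1986, (2.14) p.653, (3.94) p.669] -/
theorem posDef_effLapU_segment {t : ℝ} (ht : t ∈ Set.Icc (0 : ℝ) 1) :
    (effLapU T M a c m2 V + t • (effLapU T M a c m2 U - effLapU T M a c m2 V)).PosDef := by
  obtain ⟨h0, h1⟩ := ht
  have hVpd := posDef_effLapU T M ha hc hm hV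
  have hUpd := posDef_effLapU T M ha hc hm hU
  have e : effLapU T M a c m2 V + t • (effLapU T M a c m2 U - effLapU T M a c m2 V) = (1 - t) • effLapU T M a c m2 V + t • effLapU T M a c m2 U := by
    rw [smul_sub, sub_smul, one_smul]; abel
  rw [e]
  rcases eq_or_lt_of_le h1 with rfl | hlt
  · simpa using hUpd
  · exact (hVpd.smul (by linarith : 0 < 1 - t)).add_posSemidef (hUpd.posSemidef.smul h0)

/-- ★★★★ **`∂_t ln det Δ_t = tr(Δ_t⁻¹E)` ON `[0,1]`**, `Δ_t = Δ_eff(V) + t(Δ_eff(U) − Δ_eff(V))`, `E = Δ_eff(U) − Δ_eff(V)` — the response of King's `−2 ln N` along the segment is the trace of the covariance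
against the perturbation. [cite: King1986, (3.94)–(3.95) p.669, (3.89)–(3.90) pp.668–669; HornJohnson2013, 0.8.10 eq. (0.8.10.1)] -/
theorem hasDerivAt_log_det_effLapU_segment {t : ℝ} (ht : t ∈ Set.Icc (0 : ℝ) 1) :
    HasDerivAt (fun s : ℝ => Real.log (effLapU T M a c m2 V + s • (effLapU T M a c m2 U - effLapU T M a c m2 V)).det)
      (((effLapU T M a c m2 V + t • (effLapU T M a c m2 U - effLapU T M a c m2 V))⁻¹ * (effLapU T M a c m2 U - effLapU T M a c m2 V)).trace) t :=
  hasDerivAt_log_det_affine _ _ (posDef_effLapU_segment T M ha hc hm hU hV ht).det_pos.ne'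

/-- ★★★ **THE SLOPE AT `t = 0` IS `tr(C(V)E)`**. [cite: King1986, (3.94)–(3.96) p.669] -/
theorem hasDerivAt_log_det_effLapU_segment_zero :
    HasDerivAt (fun s : ℝ => Real.log (effLapU T M a c m2 V + s • (effLapU T M a c m2 U - effLapU T M a c m2 V)).det)
      (((effLapU T M a c m2 V)⁻¹ * (effLapU T M a c m2 U - effLapU T M a c m2 V)).trace) 0 := by
  have h := hasDerivAt_log_det_effLapU_segment T M ha hc hm hU hV (t := 0) ⟨le_rfl, zero_le_one⟩
  rwa [zero_smul, add_zero] at h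

/-- ★★★ **THE SLOPE AT `t = 1` IS `tr(C(U)E)`**. [cite: King1986, (3.94)–(3.96) p.669] -/
theorem hasDerivAt_log_det_effLapU_segment_one :
    HasDerivAt (fun s : ℝ => Real.log (effLapU T M a c m2 V + s • (effLapU T M a c m2 U - effLapU T M a c m2 V)).det)
      (((effLapU T M a c m2 U)⁻¹ * (effLapU T M a c m2 U - effLapU T M a c m2 V)).trace) 1 := by
  have h := hasDerivAt_log_det_effLapU_segment T M ha hc hm hU hV (t := 1) ⟨zero_le_one, le_rfl⟩
  rwa [one_smul, add_sub_cancel] at h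

/-- ★★★ **THE CHORD LIES BETWEEN THE ENDPOINT TANGENTS**: with `f(t) = ln det Δ_t`, `f(1) − f(0) = ln det Δ_eff(U) − ln det Δ_eff(V)` is squeezed between the slope at `t = 1` (`tr(C(U)E)`) and the slope at
`t = 0` (`tr(C(V)E)`) — PART Ϭ-f's first-order response sandwich, read as the concavity of `f` (Ϭ-f `log_det_effLapU_segment_ge`). [cite: King1986, (3.94)–(3.96) p.669, (3.89)–(3.90) pp.668–669] -/
theorem king_response_chord_between_tangents :
    (((effLapU T M a c m2 U)⁻¹ * (effLapU T M a c m2 U - effLapU T M a c m2 V)).trace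
        ≤ Real.log (effLapU T M a c m2 U).det - Real.log (effLapU T M a c m2 V).det
      ∧ Real.log (effLapU T M a c m2 U).det - Real.log (effLapU T M a c m2 V).det
        ≤ ((effLapU T M a c m2 V)⁻¹ * (effLapU T M a c m2 U - effLapU T M a c m2 V)).trace)
    ∧ HasDerivAt (fun s : ℝ => Real.log (effLapU T M a c m2 V + s • (effLapU T M a c m2 U - effLapU T M a c m2 V)).det)
        (((effLapU T M a c m2 U)⁻¹ * (effLapU T M a c m2 U - effLapU T M a c m2 V)).trace) 1
    ∧ HasDerivAt (fun s : ℝ => Real.log (effLapU T M a c m2 V + s • (effLapU T M a c m2 U - effLapU T M a c m2 V)).det)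
        (((effLapU T M a c m2 V)⁻¹ * (effLapU T M a c m2 U - effLapU T M a c m2 V)).trace) 0 := by
  have h := king_first_order_response_sandwich T M ha hc hm hU hV
  simp only [RCLike.re_to_real] at h
  exact ⟨h, hasDerivAt_log_det_effLapU_segment_one T M ha hc hm hU hV, hasDerivAt_log_det_effLapU_segment_zero T M ha hc hm hU hV⟩

end Model

end Summit.QuantumFields.YangMills.BalabanUVNodes.N15KingModelRung.Analytic

end
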